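import Mathlib
import Summits.AtomisticToContinuum.FouriersLaw.Theorems.EmbeddedDrudeMourreMourreDissolutionSlabRegionT1
import HarnessLib

/-!
# Slab non-concentration, junction region T₃ — helper file for `stub_slabNonconcentration` (stub NC)
of line `swap-odd-threshold-rigidity` (crux `EmbeddedDrudeMourre.MourreDissolution`, item
stmt-AtomisticToContinuum-12594; helper file, `--supports`)

The junction boxes `{|k₂ ∓ κ*| ≤ ρ₁, |k₃ ∓ κ*| ≤ ρ₂}` of the exchange slab `{|sin((k₃−k₁)/2)| < η}`: in the
sheared coordinates `(k₁,k₂,k₃) = (z − x, z + y, z)` (translation invariance of `dk₁`, `dk₂` for fixed `z`)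
the diagonal fibre map `z ↦ Ω(z−x, z+y, z)` has derivative the second difference
`v(z−x)+v(z+y)−v(z)−v(z−x+y)`, of sign `−sign(xy)` and modulus `≥ c_J|x||y|` where `v″ ≤ −c_J` (two
mean-value inequalities), while the weight is `≤ Cw sin²(x/2) sin²(y/2) ≤ Cw x²y²/16`; the weighted fibre
integral is `≤ Cw|x||y|r/(8c_J)` and the region bound is `≤ Cw π²η²(ρ₁+ρ₂)² r/(2c_J)`. No cited facts.
-/

noncomputable section

namespace Summit.AtomisticToContinuum.FouriersLaw.Theorems.MourreDissolution

open Real Set MeasureTheory Filter Topology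
open scoped ENNReal
open Literature.MathematicalPhysics.KineticTheory.PhononBoltzmann

/-! ### Second differences under a concavity floor -/

/-- **Second-difference floor.** If `φ″ ≤ −c` on a convex set containing `z, z−x, z+y, z−x+y`, then the
second difference `φ(z−x)+φ(z+y)−φ(z)−φ(z−x+y)` is `≤ −c|x||y|` when `xy ≥ 0` and `≥ c|x||y|` when `xy ≤ 0`
(two mean-value inequalities). [folklore] -/
theorem slabRegion_secondDiff {φ φ' φ'' : ℝ → ℝ} {D : Set ℝ} (hD : Convex ℝ D)
    (hφ : ∀ t ∈ D, HasDerivAt φ (φ' t) t) (hφ' : ∀ t ∈ D, HasDerivAt φ' (φ'' t) t) {c : ℝ}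
    (hfloor : ∀ t ∈ D, φ'' t ≤ -c) {x y z : ℝ} (hz : z ∈ D) (hzx : z - x ∈ D) (hzy : z + y ∈ D)
    (hzxy : z - x + y ∈ D) :
    (0 ≤ x * y → φ (z - x) + φ (z + y) - φ z - φ (z - x + y) ≤ -(c * |x| * |y|)) ∧
      (x * y ≤ 0 → c * |x| * |y| ≤ φ (z - x) + φ (z + y) - φ z - φ (z - x + y)) := by
  -- mean-value inequality for `φ'`
  have hc1 : ContinuousOn φ' D := fun t ht => (hφ' t ht).continuousAt.continuousWithinAt
  have hd1 : DifferentiableOn ℝ φ' (interior D) := fun t ht =>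
    (hφ' t (interior_subset ht)).differentiableAt.differentiableWithinAt
  have hb1 : ∀ t ∈ interior D, deriv φ' t ≤ -c := fun t ht => by
    rw [(hφ' t (interior_subset ht)).deriv]; exact hfloor t (interior_subset ht)
  have key1 := hD.image_sub_le_mul_sub_of_deriv_le hc1 hd1 hb1
  -- the first difference `Δ(u) = φ(u+y) − φ(u)` on the interval between `z − x` and `z`
  set Δ : ℝ → ℝ := fun u => φ (u + y) - φ u with hΔ
  set Sg : Set ℝ := uIcc (z - x) z with hSg
  have hSgD : Sg ⊆ D := hD.ordConnected.uIcc_subset hzx hz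
  have hSgD' : ∀ u ∈ Sg, u + y ∈ D := by
    intro u hu
    have hmem : u + y ∈ uIcc (z - x + y) (z + y) := by
      rw [mem_uIcc] at hu ⊢
      rcases hu with h | h
      · exact Or.inl ⟨by linarith [h.1], by linarith [h.2]⟩
      · exact Or.inr ⟨by linarith [h.1], by linarith [h.2]⟩
    exact hD.ordConnected.uIcc_subset hzxy hzy hmem
  have hΔder : ∀ u ∈ Sg, HasDerivAt Δ (φ' (u + y) - φ' u) u := fun u hu => by
    have h1 : HasDerivAt (fun u => φ (u + y)) (φ' (u + y)) u := by
      simpa [Function.comp_def] using (hφ (u + y) (hSgD' u hu)).comp u ((hasDerivAt_id u).add_const y)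
    exact h1.sub (hφ u (hSgD hu))
  have hSgc : Convex ℝ Sg := convex_uIcc _ _
  have hc2 : ContinuousOn Δ Sg := fun u hu => (hΔder u hu).continuousAt.continuousWithinAt
  have hd2 : DifferentiableOn ℝ Δ (interior Sg) := fun u hu =>
    (hΔder u (interior_subset hu)).differentiableAt.differentiableWithinAt
  have hzS : z ∈ Sg := right_mem_uIcc
  have hzxS : z - x ∈ Sg := left_mem_uIcc
  have hid : φ (z - x) + φ (z + y) - φ z - φ (z - x + y) = Δ z - Δ (z - x) := by
    simp only [hΔ]; ring
  rw [hid]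
  -- degenerate cases: `x = 0` or `y = 0` make both sides vanish
  have hdeg : x = 0 ∨ y = 0 → Δ z - Δ (z - x) = 0 ∧ c * |x| * |y| = 0 := by
    rintro (rfl | rfl)
    · simp
    · simp [hΔ]
  rcases le_total 0 y with hy | hy
  · -- `Δ' ≤ −c y` on the interval
    have hb2 : ∀ u ∈ interior Sg, deriv Δ u ≤ -(c * y) := fun u hu => by
      have hu' := interior_subset hu
      rw [(hΔder u hu').deriv]
      have := key1 u (hSgD hu') (u + y) (hSgD' u hu') (by linarith)
      nlinarith
    have key2 := hSgc.image_sub_le_mul_sub_of_deriv_le hc2 hd2 hb2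
    rcases le_total 0 x with hx | hx
    · refine ⟨fun _ => ?_, fun hxy => ?_⟩
      · rw [abs_of_nonneg hx, abs_of_nonneg hy]
        have := key2 (z - x) hzxS z hzS (by linarith)
        nlinarith
      · have h0 : x * y = 0 := le_antisymm hxy (mul_nonneg hx hy)
        obtain ⟨h1, h2⟩ := hdeg (mul_eq_zero.1 h0)
        rw [h1, h2]
    · refine ⟨fun hxy => ?_, fun _ => ?_⟩
      · have h0 : x * y = 0 := le_antisymm (mul_nonpos_of_nonpos_of_nonneg hx hy) hxy
        obtain ⟨h1, h2⟩ := hdeg (mul_eq_zero.1 h0)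
        rw [h1, h2, neg_zero]
      · rw [abs_of_nonpos hx, abs_of_nonneg hy]
        have := key2 z hzS (z - x) hzxS (by linarith)
        nlinarith
  · -- `Δ' ≥ −c y = c|y|` on the interval
    have hb2 : ∀ u ∈ interior Sg, -(c * y) ≤ deriv Δ u := fun u hu => by
      have hu' := interior_subset hu
      rw [(hΔder u hu').deriv]
      have := key1 (u + y) (hSgD' u hu') u (hSgD hu') (by linarith)
      nlinarith
    have key2 := hSgc.mul_sub_le_image_sub_of_le_deriv hc2 hd2 hb2
    rcases le_total 0 x with hx | hx
    · refine ⟨fun hxy => ?_, fun _ => ?_⟩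
      · have h0 : x * y = 0 := le_antisymm (mul_nonpos_of_nonneg_of_nonpos hx hy) hxy
        obtain ⟨h1, h2⟩ := hdeg (mul_eq_zero.1 h0)
        rw [h1, h2, neg_zero]
      · rw [abs_of_nonneg hx, abs_of_nonpos hy]
        have := key2 (z - x) hzxS z hzS (by linarith)
        nlinarith
    · refine ⟨fun _ => ?_, fun hxy => ?_⟩
      · rw [abs_of_nonpos hx, abs_of_nonpos hy]
        have := key2 z hzS (z - x) hzxS (by linarith)
        nlinarith
      · have h0 : x * y = 0 := le_antisymm hxy (mul_nonneg_of_nonpos_of_nonpos hx hy)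
        obtain ⟨h1, h2⟩ := hdeg (mul_eq_zero.1 h0)
        rw [h1, h2]


/-! ### The diagonal fibre through a junction box -/

/-- **T₃ fibre bound.** For fixed `x ≠ 0`, `y ≠ 0` with `|x| ≤ X`, `|y| ≤ Y`, on the diagonal fibre
`z ∈ [ctr − ρ₂, ctr + ρ₂]` (all four momenta `z−x, z+y, z, z−x+y` then lie in `[ctr − R, ctr + R]`,
`ρ₂ + X + Y ≤ R`, where `v″ ≤ −c_J` or `v″ ≥ c_J`) and a weight `≤ Cw sin²(x/2) sin²(y/2)`, the weighted
sublevel integral is `≤ Cw·X·Y·r/(8 c_J)`. [folklore] -/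
theorem slabRegion_T3_fibre {ω₂ : ℝ} (hω : 0 < ω₂) {ctr R cJ ρ₂ X Y Cw : ℝ} (hcJ : 0 < cJ) (hCw : 0 ≤ Cw)
    (hR : ρ₂ + X + Y ≤ R)
    (hconv : (∀ t ∈ Icc (ctr - R) (ctr + R), deriv (deriv (groupVelocity ω₂)) t ≤ -cJ) ∨
      (∀ t ∈ Icc (ctr - R) (ctr + R), cJ ≤ deriv (deriv (groupVelocity ω₂)) t))
    {x y : ℝ} (hxX : |x| ≤ X) (hyY : |y| ≤ Y) (hx0 : x ≠ 0) (hy0 : y ≠ 0) {w : ℝ → ℝ≥0∞}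
    (hw : ∀ z, w z ≤ ENNReal.ofReal (Cw * Real.sin (x / 2) ^ 2 * Real.sin (y / 2) ^ 2))
    {r : ℝ} (hr : 0 ≤ r) (E : ℝ) :
    ∫⁻ z in Icc (ctr - ρ₂) (ctr + ρ₂),
        (Ioo (E - r) (E + r)).indicator 1 (resonanceFn ω₂ (z - x) (z + y) z) * w z ≤
      ENNReal.ofReal (Cw * X * Y * r / (8 * cJ)) := by
  set v := groupVelocity ω₂ with hv
  set Z : Set ℝ := Icc (ctr - ρ₂) (ctr + ρ₂) with hZ
  set D : Set ℝ := Icc (ctr - R) (ctr + R) with hD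
  set g : ℝ → ℝ := fun z => resonanceFn ω₂ (z - x) (z + y) z with hg
  set g' : ℝ → ℝ := fun z => v (z - x) + v (z + y) - v z - v (z - x + y) with hg'
  have hder : ∀ z, HasDerivAt g (g' z) z := fun z => slabFibre_hasDerivAt_diag hω x y z
  have hxa := abs_le.1 hxX
  have hya := abs_le.1 hyY
  have hmemD : ∀ z ∈ Z, z ∈ D ∧ z - x ∈ D ∧ z + y ∈ D ∧ z - x + y ∈ D := fun z hz =>
    ⟨⟨by linarith [hz.1], by linarith [hz.2]⟩, ⟨by linarith [hz.1], by linarith [hz.2]⟩,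
      ⟨by linarith [hz.1], by linarith [hz.2]⟩, ⟨by linarith [hz.1], by linarith [hz.2]⟩⟩
  set m : ℝ := cJ * |x| * |y| with hm
  have hmpos : 0 < m := by positivity
  -- derivative data of `v` and `−v`
  have hv1 : ∀ t ∈ D, HasDerivAt v (deriv v t) t := fun t _ =>
    (hasDerivAt_groupVelocity hω t).differentiableAt.hasDerivAt
  have hv2 : ∀ t ∈ D, HasDerivAt (deriv v) (deriv (deriv v) t) t := fun t _ =>
    (velShape_hasDerivAt_deriv hω t).differentiableAt.hasDerivAt
  -- the second difference has a fixed sign and modulus `≥ m` on `Z`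
  have hsd : (∀ z ∈ Z, g' z ≤ -m) ∨ (∀ z ∈ Z, m ≤ g' z) := by
    rcases hconv with hneg | hpos
    · rcases le_total 0 (x * y) with hxy | hxy
      · left; intro z hz
        obtain ⟨h1, h2, h3, h4⟩ := hmemD z hz
        exact (slabRegion_secondDiff (convex_Icc _ _) hv1 hv2 hneg h1 h2 h3 h4).1 hxy
      · right; intro z hz
        obtain ⟨h1, h2, h3, h4⟩ := hmemD z hz
        exact (slabRegion_secondDiff (convex_Icc _ _) hv1 hv2 hneg h1 h2 h3 h4).2 hxy
    · -- apply the lemma to `−v`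
      have hn1 : ∀ t ∈ D, HasDerivAt (fun t => -v t) (-deriv v t) t := fun t ht => (hv1 t ht).neg
      have hn2 : ∀ t ∈ D, HasDerivAt (fun t => -deriv v t) (-deriv (deriv v) t) t := fun t ht =>
        (hv2 t ht).neg
      have hnf : ∀ t ∈ D, -deriv (deriv v) t ≤ -cJ := fun t ht => by linarith [hpos t ht]
      rcases le_total 0 (x * y) with hxy | hxy
      · right; intro z hz
        obtain ⟨h1, h2, h3, h4⟩ := hmemD z hz
        have := (slabRegion_secondDiff (convex_Icc _ _) hn1 hn2 hnf h1 h2 h3 h4).1 hxy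
        simp only [hg']; linarith
      · left; intro z hz
        obtain ⟨h1, h2, h3, h4⟩ := hmemD z hz
        have := (slabRegion_secondDiff (convex_Icc _ _) hn1 hn2 hnf h1 h2 h3 h4).2 hxy
        simp only [hg']; linarith
  have hexp : ∀ s ∈ Z, ∀ t ∈ Z, m * |t - s| ≤ |g t - g s| := by
    rcases hsd with h | h
    · exact slabFibre_expand_of_deriv_le (convex_Icc _ _) (fun z _ => hder z) h
    · exact slabFibre_expand_of_deriv_ge (convex_Icc _ _) (fun z _ => hder z) h
  have h := slabFibre_weighted_le (g := g) measurableSet_Icc hmpos hexp (fun z _ => hw z) E r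
  refine h.trans ?_
  rw [← ENNReal.ofReal_mul (by positivity)]
  apply ENNReal.ofReal_le_ofReal
  have hsx : Real.sin (x / 2) ^ 2 ≤ (x / 2) ^ 2 := by
    rw [← sq_abs (Real.sin _), ← sq_abs (x / 2)]
    exact pow_le_pow_left₀ (abs_nonneg _) Real.abs_sin_le_abs 2
  have hsy : Real.sin (y / 2) ^ 2 ≤ (y / 2) ^ 2 := by
    rw [← sq_abs (Real.sin _), ← sq_abs (y / 2)]
    exact pow_le_pow_left₀ (abs_nonneg _) Real.abs_sin_le_abs 2
  have hxpos : 0 < |x| := abs_pos.2 hx0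
  have hypos : 0 < |y| := abs_pos.2 hy0
  calc Cw * Real.sin (x / 2) ^ 2 * Real.sin (y / 2) ^ 2 * (2 * r / m)
      ≤ Cw * (x / 2) ^ 2 * (y / 2) ^ 2 * (2 * r / m) := by gcongr
    _ = Cw * |x| * |y| * r / (8 * cJ) := by
        rw [hm, show (x / 2) ^ 2 = |x| ^ 2 / 4 by rw [sq_abs x]; ring,
          show (y / 2) ^ 2 = |y| ^ 2 / 4 by rw [sq_abs y]; ring]
        field_simp
        ring
    _ ≤ Cw * X * Y * r / (8 * cJ) := by
        have hX0 : 0 ≤ X := (abs_nonneg x).trans hxX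
        gcongr


/-! ### From a small half-angle sine to a small angle -/

/-- If `|t| ≤ 5π/6`, `|sin t| < η ≤ 1/2` then `|t| < πη/2` (Jordan's inequality on `[−π/2, π/2]`, and
`|sin t| ≥ 1/2` on `π/2 ≤ |t| ≤ 5π/6`). [folklore] -/
theorem slabRegion_abs_lt_of_abs_sin_lt {t η : ℝ} (ht : |t| ≤ 5 * π / 6) (hη : η ≤ 1 / 2)
    (hs : |Real.sin t| < η) : |t| < π * η / 2 := by
  have hpi := pi_pos
  -- `|sin t| = sin |t|` for `|t| ≤ π`
  have habs : |Real.sin t| = Real.sin |t| := by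
    rcases le_or_gt 0 t with h | h
    · rw [abs_of_nonneg h, abs_of_nonneg (Real.sin_nonneg_of_nonneg_of_le_pi h (by linarith [abs_le.1 ht]))]
    · rw [abs_of_neg h, Real.sin_neg, abs_of_nonpos]
      have : Real.sin (-t) ≥ 0 := Real.sin_nonneg_of_nonneg_of_le_pi (by linarith)
        (by linarith [(abs_le.1 ht).1])
      rw [Real.sin_neg] at this; linarith
  rcases le_or_gt |t| (π / 2) with h1 | h1
  · have hj := Real.mul_le_sin (abs_nonneg t) h1
    rw [← habs] at hj
    have : 2 / π * |t| < η := hj.trans_lt hs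
    rw [div_mul_eq_mul_div, div_lt_iff₀ hpi] at this
    linarith
  · exfalso
    have h2 : Real.sin (π / 6) ≤ Real.sin (π - |t|) :=
      Real.sin_le_sin_of_le_of_le_pi_div_two (by linarith) (by linarith) (by linarith)
    rw [Real.sin_pi_sub, Real.sin_pi_div_six, ← habs] at h2
    linarith

/-! ### Region T₃: the junction boxes -/

/-- **Region T₃.** The weighted sublevel mass of the junction box `{|k₂ − ctr| ≤ ρ₁, |k₃ − ctr| ≤ ρ₂}` of
the slab `{|sin((k₃−k₁)/2)| < η}` (`ctr ∈ {κ*, −κ*}`, `|ctr| + ρ₂ ≤ 2π/3`, `η ≤ 1/2`) is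
`≤ Cw·(πη)(ρ₁+ρ₂)·r/(8c_J) · 2(ρ₁+ρ₂) · 2πη` (diagonal fibres in the sheared coordinates
`(k₁,k₂,k₃) = (z − x, z + y, z)`). [folklore] -/
theorem slabRegion_T3 {ω₂ : ℝ} (hω : 0 < ω₂) {ctr R cJ ρ₁ ρ₂ η Cw : ℝ} (hcJ : 0 < cJ) (hCw : 0 ≤ Cw)
    (hη : 0 < η) (hη2 : η ≤ 1 / 2) (hρ₁ : 0 ≤ ρ₁) (hρ₂ : 0 ≤ ρ₂) (hctr : |ctr| + ρ₂ ≤ 2 * π / 3)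
    (hR : ρ₂ + π * η + (ρ₁ + ρ₂) ≤ R)
    (hconv : (∀ t ∈ Icc (ctr - R) (ctr + R), deriv (deriv (groupVelocity ω₂)) t ≤ -cJ) ∨
      (∀ t ∈ Icc (ctr - R) (ctr + R), cJ ≤ deriv (deriv (groupVelocity ω₂)) t))
    {w : ℝ × ℝ × ℝ → ℝ≥0∞} (hwm : Measurable w)
    (hw : ∀ p, w p ≤ ENNReal.ofReal (Cw * Real.sin ((p.2.1 - p.1) / 2) ^ 2 *
      Real.sin ((p.2.2 - p.2.1) / 2) ^ 2)) {r : ℝ} (hr : 0 ≤ r) (E : ℝ) :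
    ∫⁻ p in (Ioc (-π) π ×ˢ (Ioc (-π) π ×ˢ Ioc (-π) π)) ∩ {p | |Real.sin ((p.2.1 - p.1) / 2)| < η} ∩
        {p | |p.2.2 - ctr| ≤ ρ₁ ∧ |p.2.1 - ctr| ≤ ρ₂},
      (Ioo (E - r) (E + r)).indicator 1 (resonanceFn ω₂ p.1 p.2.2 p.2.1) * w p ≤
      ENNReal.ofReal (Cw * (π * η) * (ρ₁ + ρ₂) * r / (8 * cJ) * (2 * (ρ₁ + ρ₂) * (2 * (π * η)))) := by
  have hpi := pi_pos
  set I : Set ℝ := Ioc (-π) π with hI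
  set F : ℝ × ℝ × ℝ → ℝ≥0∞ := fun p =>
    (Ioo (E - r) (E + r)).indicator 1 (resonanceFn ω₂ p.1 p.2.2 p.2.1) * w p with hF
  set S : Set (ℝ × ℝ × ℝ) := (I ×ˢ (I ×ˢ I)) ∩ {p | |Real.sin ((p.2.1 - p.1) / 2)| < η} ∩
    {p | |p.2.2 - ctr| ≤ ρ₁ ∧ |p.2.1 - ctr| ≤ ρ₂} with hS
  set Bx : Set (ℝ × ℝ × ℝ) := {p | |p.2.1 - p.1| ≤ π * η ∧ |p.2.2 - ctr| ≤ ρ₁ ∧ |p.2.1 - ctr| ≤ ρ₂}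
    with hBx
  -- the slab part of the junction box lies in the sheared box
  have hSB : S ⊆ Bx := by
    rintro p ⟨⟨hQ, hsl⟩, hN⟩
    refine ⟨?_, hN.1, hN.2⟩
    have hk₁ : p.1 ∈ I := hQ.1
    have hk₃ : |p.2.1| ≤ 2 * π / 3 := by
      have := abs_sub_abs_le_abs_sub p.2.1 ctr
      linarith [hN.2]
    have ht : |(p.2.1 - p.1) / 2| ≤ 5 * π / 6 := by
      rw [abs_div, abs_two]
      have : |p.2.1 - p.1| ≤ |p.2.1| + |p.1| := abs_sub _ _
      have hk₁' : |p.1| ≤ π := abs_le.2 ⟨by linarith [hk₁.1], hk₁.2⟩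
      linarith
    have := slabRegion_abs_lt_of_abs_sin_lt ht hη2 hsl
    rw [abs_div, abs_two] at this
    linarith
  have hBm : MeasurableSet Bx := by
    have h1 : MeasurableSet {p : ℝ × ℝ × ℝ | |p.2.1 - p.1| ≤ π * η} :=
      (isClosed_le (by fun_prop : Continuous fun p : ℝ × ℝ × ℝ => |p.2.1 - p.1|) continuous_const).measurableSet
    have h2 : MeasurableSet {p : ℝ × ℝ × ℝ | |p.2.2 - ctr| ≤ ρ₁} :=
      (isClosed_le (by fun_prop : Continuous fun p : ℝ × ℝ × ℝ => |p.2.2 - ctr|) continuous_const).measurableSet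
    have h3 : MeasurableSet {p : ℝ × ℝ × ℝ | |p.2.1 - ctr| ≤ ρ₂} :=
      (isClosed_le (by fun_prop : Continuous fun p : ℝ × ℝ × ℝ => |p.2.1 - ctr|) continuous_const).measurableSet
    simpa only [hBx, setOf_and] using h1.inter (h2.inter h3)
  have hFm : Measurable F := slabRegion_measurable_F hwm E r
  have hBFm : Measurable (Bx.indicator F) := hFm.indicator hBm
  -- the sheared integrand
  set Ψ : ℝ × ℝ × ℝ → ℝ≥0∞ := fun a => Bx.indicator F (a.1 - a.2.2, (a.1, a.1 + a.2.1)) with hΨ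
  have hΨm : Measurable Ψ := hBFm.comp (by fun_prop)
  set B₃ : ℝ≥0∞ := ENNReal.ofReal (Cw * (π * η) * (ρ₁ + ρ₂) * r / (8 * cJ)) with hB₃
  set box : Set (ℝ × ℝ) := Icc (-(ρ₁ + ρ₂)) (ρ₁ + ρ₂) ×ˢ Icc (-(π * η)) (π * η) with hbox
  -- the diagonal fibre bound, pointwise in `q = (y, x)`
  have hfib : ∀ q : ℝ × ℝ, ∫⁻ k₃, Ψ (k₃, q) ≤ box.indicator (fun _ => B₃) q := by
    rintro ⟨y, x⟩
    -- membership in `Bx` along the fibre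
    have hmemBx : ∀ k₃, (k₃ - x, (k₃, k₃ + y)) ∈ Bx → k₃ ∈ Icc (ctr - ρ₂) (ctr + ρ₂) ∧
        |x| ≤ π * η ∧ |y| ≤ ρ₁ + ρ₂ := by
      intro k₃ hk
      simp only [hBx, mem_setOf_eq, show k₃ - (k₃ - x) = x by ring, show k₃ + y - ctr = (k₃ - ctr) + y by ring]
        at hk
      obtain ⟨h1, h2, h3⟩ := hk
      refine ⟨⟨by linarith [(abs_le.1 h3).1], by linarith [(abs_le.1 h3).2]⟩, h1, ?_⟩
      have : |y| ≤ |k₃ - ctr + y| + |k₃ - ctr| := by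
        rw [show y = (k₃ - ctr + y) - (k₃ - ctr) by ring]
        exact (abs_sub _ _).trans (by rw [show k₃ - ctr + y - (k₃ - ctr) = y by ring])
      linarith
    by_cases hq : ((y, x) : ℝ × ℝ) ∈ box
    · rw [indicator_of_mem hq]
      have hqy : |y| ≤ ρ₁ + ρ₂ := abs_le.2 hq.1
      have hqx : |x| ≤ π * η := abs_le.2 hq.2
      have hpt : ∀ k₃, Ψ (k₃, (y, x)) ≤ (Icc (ctr - ρ₂) (ctr + ρ₂)).indicator
          (fun k₃ => (Ioo (E - r) (E + r)).indicator 1 (resonanceFn ω₂ (k₃ - x) (k₃ + y) k₃) *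
            w (k₃ - x, (k₃, k₃ + y))) k₃ := by
        intro k₃
        simp only [hΨ]
        by_cases hk : (k₃ - x, (k₃, k₃ + y)) ∈ Bx
        · rw [indicator_of_mem hk, indicator_of_mem (hmemBx k₃ hk).1]
        · rw [indicator_of_notMem hk]; exact bot_le
      have hw' : ∀ k₃, w (k₃ - x, (k₃, k₃ + y)) ≤
          ENNReal.ofReal (Cw * Real.sin (x / 2) ^ 2 * Real.sin (y / 2) ^ 2) := fun k₃ => by
        have := hw (k₃ - x, (k₃, k₃ + y))
        simp only [show k₃ - (k₃ - x) = x by ring, show k₃ + y - k₃ = y by ring] at this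
        exact this
      calc ∫⁻ k₃, Ψ (k₃, (y, x)) ≤ _ := lintegral_mono hpt
        _ = ∫⁻ k₃ in Icc (ctr - ρ₂) (ctr + ρ₂),
              (Ioo (E - r) (E + r)).indicator 1 (resonanceFn ω₂ (k₃ - x) (k₃ + y) k₃) *
                w (k₃ - x, (k₃, k₃ + y)) := lintegral_indicator measurableSet_Icc _
        _ ≤ B₃ := by
            by_cases h0 : x = 0 ∨ y = 0
            · -- degenerate fibre: the weight vanishes
              have hw0 : ∀ k₃, w (k₃ - x, (k₃, k₃ + y)) = 0 := fun k₃ => by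
                have h1 := hw' k₃
                have hz : Cw * Real.sin (x / 2) ^ 2 * Real.sin (y / 2) ^ 2 = 0 := by
                  rcases h0 with h | h <;> simp [h]
                rw [hz, ENNReal.ofReal_zero] at h1
                exact nonpos_iff_eq_zero.1 h1
              simp only [hw0, mul_zero, lintegral_zero]; exact bot_le
            · push Not at h0
              exact slabRegion_T3_fibre hω hcJ hCw (X := π * η) (Y := ρ₁ + ρ₂) (by linarith) hconv hqx hqy
                h0.1 h0.2 hw' hr E
    · rw [indicator_of_notMem hq]
      have h0 : ∀ k₃, Ψ (k₃, (y, x)) = 0 := by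
        intro k₃
        simp only [hΨ]
        apply indicator_of_notMem
        intro hk
        obtain ⟨-, h2, h3⟩ := hmemBx k₃ hk
        exact hq ⟨abs_le.1 h3, abs_le.1 h2⟩
      simp only [h0, lintegral_zero]; exact le_rfl
  have hboxm : MeasurableSet box := measurableSet_Icc.prod measurableSet_Icc
  have hboxvol : volume box = ENNReal.ofReal (2 * (ρ₁ + ρ₂)) * ENNReal.ofReal (2 * (π * η)) := by
    rw [hbox, Measure.volume_eq_prod, Measure.prod_prod, Real.volume_Icc, Real.volume_Icc]
    congr 1 <;> congr 1 <;> ring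
  calc ∫⁻ p in S, F p ≤ ∫⁻ p in Bx, F p := lintegral_mono_set hSB
    _ = ∫⁻ p, Bx.indicator F p := (lintegral_indicator hBm F).symm
    _ = ∫⁻ q, ∫⁻ k₁, Bx.indicator F (k₁, q) := by
        rw [Measure.volume_eq_prod]; exact lintegral_prod_symm _ hBFm.aemeasurable
    _ ≤ ∫⁻ k₃, ∫⁻ k₂, ∫⁻ k₁, Bx.indicator F (k₁, (k₃, k₂)) := by
        rw [Measure.volume_eq_prod]; exact lintegral_prod_le _
    _ = ∫⁻ k₃, ∫⁻ y, ∫⁻ x, Bx.indicator F (k₃ - x, (k₃, k₃ + y)) := by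
        refine lintegral_congr fun k₃ => ?_
        rw [← lintegral_add_left_eq_self _ k₃]
        refine lintegral_congr fun y => ?_
        rw [← lintegral_sub_left_eq_self _ k₃]
    _ = ∫⁻ k₃, ∫⁻ q, Ψ (k₃, q) := by
        refine lintegral_congr fun k₃ => ?_
        rw [Measure.volume_eq_prod]
        exact (lintegral_prod (fun q : ℝ × ℝ => Ψ (k₃, q)) (hΨm.comp measurable_prodMk_left).aemeasurable).symm
    _ = ∫⁻ q, ∫⁻ k₃, Ψ (k₃, q) :=
        lintegral_lintegral_swap (f := fun k₃ q => Ψ (k₃, q)) hΨm.aemeasurable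
    _ ≤ ∫⁻ q, box.indicator (fun _ => B₃) q := lintegral_mono hfib
    _ = B₃ * volume box := lintegral_indicator_const hboxm _
    _ = _ := by
        rw [hboxvol, hB₃, ← ENNReal.ofReal_mul (by positivity), ← ENNReal.ofReal_mul (by positivity)]

end Summit.AtomisticToContinuum.FouriersLaw.Theorems.MourreDissolution
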